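import Summits.MatrixMultiplication.MatrixMultiplication.Theorems.SaturationLadderThinRoof
import Summits.MatrixMultiplication.MatrixMultiplication.Theorems.FarEdgeDescentTowerPairs
import HarnessLib

/-!
# Route `SaturationLadder` on Strassen's spectrum, IV: the FACE MODULUS — the darkness of the
# matrix-multiplication spectrum is Hölder of exponent `log 2/log 11` in the depth below the light face

decomp-mm lens 1 «grading / quantitative ladder», gen 44, kernel K44-F (chain file 4; files 1–3 =
`SaturationLadderThinRoof`, `SaturationLadderCornerGerm`, `SaturationLadderCornerModulus`).  Def-free, sorry-free,
THESES-FREE support (imports two landed `Theorems` modules) beneath the deciding crux `SubexpSaturation`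
(stmt-MatrixMultiplication-25909) of `route-MatrixMultiplication-SaturationLadder`; cut of record UNCHANGED
(`closes (h₁ : SubexpSaturation) (h₂ : SubexpToPoly) (h₃ : PolyToFinite) (h₄ : TailDescentTwo) (h₅ : SquareFromTwo)`).

For a universal spectral point `φ` over a field `K` write `θ = specMMPoint K φ ∈ [0,1]³`, DARKNESS
`d = θ₀+θ₁+θ₂−2` and DEPTH `ε₂ = 1−θ₂` below the light face `{θ₂ = 1}` (on which `d ≤ 0`, file 3's `face_light`).
File 3 graded the LENGTH side of the cut by the CORNER modulus of `d` (logarithmic scale `d·log(θ₁/ε₂) ≤ κθ₁`).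
This file grades the RATE side — the far-edge excess `e(k) = ω(1,k,1) − (k+1)` of route `FarEdgeDescent` and the
face laws `FS_k : d ≤ (k−1)ε₂` of this route's tail (`farTight_iff_roof`) — by the FACE MODULUS of `d`: the
Hölder law `d ≤ B·ε₂^α` at EVERY universal spectral point.  The two gradings are LEGENDRE DUAL:

* §1 two exchange lemmas of real analysis: a power rate `e(n) ≤ C·n^{−δ}` (`n ≥ 1`) in the height law
  `d ≤ (n−1)ε + e(n)` forces the Hölder law `d ≤ 2·C^{1/(1+δ)}·ε^{δ/(1+δ)}` (`holder_of_rate`, optimum at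
  `n = ⌈(Cε^δ)^{1/(1+δ)}/ε⌉`), and a Hölder law `d ≤ B·ε^α` (`0 < α < 1`, `ε ≤ 1`) forces
  `d ≤ (k−1)ε + 2^β(B + B·B^β)·k^{−β}` for every real `k ≥ 1`, `β = α/(1−α)` (`rate_of_holder`).
* §2 ★★ on the spectrum, over EVERY field: `e(k) ≤ C·k^{−δ}` (real or integer `k ≥ 1`) ⟹ the Hölder face law of
  exponent `δ/(1+δ)` (`holderFace_of_farRate`, `holderFace_of_farRate_nat`), and the Hölder face law of exponent
  `α` ⟹ `e(k) ≤ B'·k^{−α/(1−α)}` for every real `k ≥ 1` (`farRate_of_holderFace`; Strassen duality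
  `ω(1,1,k) = sup_φ(θ₀+θ₁+kθ₂)`, file 1's `isLUB_plane`).  So the RATE EXPONENT `δ` of `FarEdgeDescent` and the
  FACE HÖLDER EXPONENT `α` of this route are one number in two charts: `α = δ/(1+δ)`, `δ = α/(1−α)`.
* §3 ★★ PROVED RUNG: lens 2's pair-order tower `e(k) ≤ 4·k^{−log 2/log(11/2)}` (`FarEdgeDescentTowerPairs`) is,
  on the spectrum, the Hölder face law **`d ≤ 2·4^{log(11/2)/log 11}·ε₂^{log 2/log 11}`** at every universal
  spectral point over every field (`holderFace_pairOrder`; exponent `log 2/log 11 = 0.2890…`, constant `5.359…`),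
  with the clean rung **`d ≤ 6·ε₂^{2/7}`** (`holderFace_two_sevenths`, from `e(k) ≤ 4k^{−2/5}`).

The face ladder of the route thus reads, in ONE modulus: Hölder `log 2/log 11` (PROVED) → Hölder `α` for every
`α < 1` (= `RateBeyond θ` for every `θ`, lens 2's dial) → Lipschitz `d ≤ (k−1)ε₂` (= `FS_k`, `h₃`'s consequent;
`h₄`: slope `k−1 ≥ 2` ⟹ slope `1`) → `d ≤ ε₂` (`E₂`) → `d ≤ 0` (`ω = 2`, `h₅`).  Nothing here proves `ω = 2` or an
open item; no definitions (gate rule D-0009).  [cite: Strassen1988, Thm. 3.8] [cite: LottiRomani1983, Prop. 4.1]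
[cite: CoppersmithWinograd1982, Thm. 1] [cite: AlmanLi2026, Proposition 4.2] [cite: HuangPan1998, (2.8)]
-/

set_option linter.dupNamespace false

noncomputable section

open scoped BigOperators

namespace Summit.MatrixMultiplication.MatrixMultiplication.Theorems.SaturationLadderFaceModulus

open Literature.Computability.AlgebraicComplexity
open Summit.MatrixMultiplication.MatrixMultiplication.Theorems.SaturationLadderThinRoof
open Summit.MatrixMultiplication.MatrixMultiplication.Theorems.FarEdgeDescentTowerPairs
  (excess_le_four_mul_rpow_pairOrder excess_le_four_mul_rpow_two_fifths)

variable {K : Type} [Field K]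

/-! ## §1 Two exchange lemmas (power rate ⟷ Hölder exponent) -/

/-- ★ **Rate ⟹ Hölder** (Legendre exchange, discrete): if `d ≤ (n−1)·ε + C·n^{−δ}` for every integer `n ≥ 1`
(`ε ≥ 0`, `C, δ > 0`), then `d ≤ 2·C^{1/(1+δ)}·ε^{δ/(1+δ)}`.  With `M = (Cε^δ)^{1/(1+δ)}`: for `ε ≤ C` the
integer `n = ⌈M/ε⌉ ≥ 1` gives `(n−1)ε ≤ M` and `C·n^{−δ} ≤ C·(M/ε)^{−δ} = M`; for `ε > C`, `n = 1` gives
`d ≤ C ≤ M`; for `ε = 0`, `n → ∞`. [folklore] -/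
theorem holder_of_rate {d ε C δ : ℝ} (hε : 0 ≤ ε) (hC : 0 < C) (hδ : 0 < δ)
    (h : ∀ n : ℕ, 1 ≤ n → d ≤ ((n : ℝ) - 1) * ε + C * (n : ℝ) ^ (-δ)) :
    d ≤ 2 * C ^ (1 / (1 + δ)) * ε ^ (δ / (1 + δ)) := by
  have h1δ : 0 < 1 + δ := by linarith
  set a : ℝ := 1 / (1 + δ) with ha
  have ha0 : 0 < a := by positivity
  -- the common value `M = (C ε^δ)^a = C^a ε^{δ/(1+δ)}`
  have hM : (C * ε ^ δ) ^ a = C ^ a * ε ^ (δ / (1 + δ)) := by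
    rw [Real.mul_rpow hC.le (Real.rpow_nonneg hε _), ← Real.rpow_mul hε]
    congr 1
    rw [ha]
    field_simp
  have hgoal : 2 * C ^ (1 / (1 + δ)) * ε ^ (δ / (1 + δ)) = 2 * (C * ε ^ δ) ^ a := by
    rw [hM, ha]
    ring
  rw [hgoal]
  rcases hε.eq_or_lt with hε0 | hε0
  · -- `ε = 0`: `d ≤ 0`, letting `n → ∞`
    rw [← hε0, Real.zero_rpow hδ.ne', mul_zero, Real.zero_rpow ha0.ne', mul_zero]
    refine le_of_forall_pos_lt_add fun η hη => ?_
    set n : ℕ := ⌈(C / η) ^ (1 / δ)⌉₊ + 1 with hn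
    have hn1 : 1 ≤ n := by omega
    have hx0 : 0 ≤ (C / η) ^ (1 / δ) := Real.rpow_nonneg (by positivity) _
    have hnx : (C / η) ^ (1 / δ) < n := by
      rw [hn]
      push_cast
      exact lt_of_le_of_lt (Nat.le_ceil _) (lt_add_one _)
    have hn0 : (0 : ℝ) < n := by exact_mod_cast (by omega : 0 < n)
    have hpow : C / η < (n : ℝ) ^ δ := by
      have := Real.rpow_lt_rpow hx0 hnx hδ
      rwa [← Real.rpow_mul (by positivity : (0 : ℝ) ≤ C / η), one_div_mul_cancel hδ.ne',
        Real.rpow_one] at this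
    have hd := h n hn1
    rw [← hε0, mul_zero, zero_add, Real.rpow_neg hn0.le] at hd
    have hnδ : 0 < (n : ℝ) ^ δ := Real.rpow_pos_of_pos hn0 δ
    have hCη : C < (n : ℝ) ^ δ * η := by
      have := (div_lt_iff₀ hη).1 hpow
      linarith
    have : C * ((n : ℝ) ^ δ)⁻¹ < η := by
      rw [← div_eq_mul_inv, div_lt_iff₀ hnδ]
      linarith
    linarith
  · -- `ε > 0`
    set M : ℝ := (C * ε ^ δ) ^ a with hMdef
    have hεδ : 0 < ε ^ δ := Real.rpow_pos_of_pos hε0 δ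
    have hCe : 0 < C * ε ^ δ := mul_pos hC hεδ
    have hM0 : 0 < M := Real.rpow_pos_of_pos hCe a
    have hMpow : M ^ (1 + δ) = C * ε ^ δ := by
      rw [hMdef, ← Real.rpow_mul hCe.le, ha, one_div_mul_cancel h1δ.ne', Real.rpow_one]
    have hM1 : M ^ (1 + δ) = M * M ^ δ := by
      rw [Real.rpow_add hM0, Real.rpow_one]
    have hMδ : 0 < M ^ δ := Real.rpow_pos_of_pos hM0 δ
    by_cases hCε : ε ≤ C
    · -- interior optimum `n = ⌈M/ε⌉`
      have hk₀ : 1 ≤ M / ε := by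
        rw [le_div_iff₀ hε0, one_mul]
        have h1 : ε = (ε ^ (1 + δ)) ^ a := by
          rw [← Real.rpow_mul hε, ha, mul_one_div_cancel h1δ.ne', Real.rpow_one]
        have h2 : ε ^ (1 + δ) ≤ C * ε ^ δ := by
          rw [Real.rpow_add hε0, Real.rpow_one]
          exact mul_le_mul_of_nonneg_right hCε hεδ.le
        rw [h1, hMdef]
        exact Real.rpow_le_rpow (Real.rpow_nonneg hε _) h2 ha0.le
      have hk₀0 : 0 < M / ε := by positivity
      set n : ℕ := ⌈M / ε⌉₊ with hn
      have hn1 : 1 ≤ n := Nat.one_le_ceil_iff.2 hk₀0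
      have hnlo : M / ε ≤ n := Nat.le_ceil _
      have hnhi : (n : ℝ) < M / ε + 1 := Nat.ceil_lt_add_one hk₀0.le
      have hd := h n hn1
      have h1 : ((n : ℝ) - 1) * ε ≤ M := by
        have : ((n : ℝ) - 1) * ε ≤ M / ε * ε := mul_le_mul_of_nonneg_right (by linarith) hε0.le
        rwa [div_mul_cancel₀ _ hε0.ne'] at this
      have h2 : C * (n : ℝ) ^ (-δ) ≤ M := by
        have hmono : (n : ℝ) ^ (-δ) ≤ (M / ε) ^ (-δ) :=
          Real.rpow_le_rpow_of_nonpos hk₀0 hnlo (by linarith)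
        have hval : C * (M / ε) ^ (-δ) = M := by
          rw [Real.div_rpow hM0.le hε0.le, Real.rpow_neg hM0.le, Real.rpow_neg hε0.le, inv_div_inv,
            mul_div_assoc', div_eq_iff hMδ.ne', ← hM1, hMpow]
        calc C * (n : ℝ) ^ (-δ) ≤ C * (M / ε) ^ (-δ) := mul_le_mul_of_nonneg_left hmono hC.le
          _ = M := hval
      linarith
    · -- shallow `ε > C`: `n = 1`
      push Not at hCε
      have hd := h 1 le_rfl
      simp only [Nat.cast_one, sub_self, zero_mul, zero_add, Real.one_rpow, mul_one] at hd
      have hCM : C ≤ M := by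
        have h1 : C = (C ^ (1 + δ)) ^ a := by
          rw [← Real.rpow_mul hC.le, ha, mul_one_div_cancel h1δ.ne', Real.rpow_one]
        have h2 : C ^ (1 + δ) ≤ C * ε ^ δ := by
          rw [Real.rpow_add hC, Real.rpow_one]
          exact mul_le_mul_of_nonneg_left (Real.rpow_le_rpow hC.le hCε.le hδ.le) hC.le
        rw [h1, hMdef]
        exact Real.rpow_le_rpow (Real.rpow_nonneg hC.le _) h2 ha0.le
      linarith

/-- ★ **Hölder ⟹ rate** (Legendre exchange, continuous): if `d ≤ B·ε^α` with `0 ≤ ε ≤ 1`, `B > 0`, `0 < α < 1`,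
then for every real `k ≥ 1`, `d ≤ (k−1)·ε + 2^β·(B + B·B^β)·k^{−β}` with `β = α/(1−α)`: for `k ≤ 2` use
`d ≤ B ≤ 2^β B k^{−β}`; for `k ≥ 2` either `Bε^α ≤ (k/2)ε ≤ (k−1)ε`, or `ε^{1−α} < 2B/k` and then
`Bε^α < B(2B/k)^β`. [folklore] -/
theorem rate_of_holder {d ε B α : ℝ} (hε : 0 ≤ ε) (hε1 : ε ≤ 1) (hB : 0 < B) (hα : 0 < α) (hα1 : α < 1)
    (h : d ≤ B * ε ^ α) {k : ℝ} (hk : 1 ≤ k) :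
    d ≤ (k - 1) * ε + 2 ^ (α / (1 - α)) * (B + B * B ^ (α / (1 - α))) * k ^ (-(α / (1 - α))) := by
  set β : ℝ := α / (1 - α) with hβ
  have h1α : 0 < 1 - α := by linarith
  have hβ0 : 0 < β := by positivity
  have hk0 : 0 < k := by linarith
  have hεα : 0 ≤ ε ^ α := Real.rpow_nonneg hε _
  have hεα1 : ε ^ α ≤ 1 := Real.rpow_le_one hε hε1 hα.le
  have hdB : d ≤ B := by nlinarith
  have hBβ : 0 < B ^ β := Real.rpow_pos_of_pos hB β
  have hkβ : 0 < k ^ (-β) := Real.rpow_pos_of_pos hk0 _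
  have h2β : 0 < (2 : ℝ) ^ β := Real.rpow_pos_of_pos two_pos β
  have hkε : 0 ≤ (k - 1) * ε := mul_nonneg (by linarith) hε
  by_cases hk2 : k ≤ 2
  · -- `k ≤ 2`: `2^β k^{-β} ≥ 1`
    have hone : 1 ≤ (2 : ℝ) ^ β * k ^ (-β) := by
      have hmono : (2 : ℝ) ^ (-β) ≤ k ^ (-β) := Real.rpow_le_rpow_of_nonpos hk0 hk2 (by linarith)
      have hinv : (2 : ℝ) ^ β * (2 : ℝ) ^ (-β) = 1 := by
        rw [Real.rpow_neg zero_le_two, mul_inv_cancel₀ h2β.ne']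
      nlinarith
    have : B ≤ 2 ^ β * (B + B * B ^ β) * k ^ (-β) := by
      have hB' : B ≤ B + B * B ^ β := le_add_of_nonneg_right (by positivity)
      nlinarith
    linarith
  · push Not at hk2
    by_cases hcase : B * ε ^ α ≤ k / 2 * ε
    · -- the linear term absorbs the Hölder bound
      have : k / 2 * ε ≤ (k - 1) * ε := mul_le_mul_of_nonneg_right (by linarith) hε
      have hpos : 0 ≤ 2 ^ β * (B + B * B ^ β) * k ^ (-β) := by positivity
      linarith
    · push Not at hcase
      -- then `ε > 0` and `ε^{1-α} < 2B/k`
      have hε0 : 0 < ε := by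
        rcases hε.eq_or_lt with h0 | h0
        · exfalso
          rw [← h0, Real.zero_rpow hα.ne', mul_zero, mul_zero] at hcase
          exact lt_irrefl _ hcase
        · exact h0
      have hsplit : ε = ε ^ (1 - α) * ε ^ α := by
        rw [← Real.rpow_add hε0, sub_add_cancel, Real.rpow_one]
      have hlt : ε ^ (1 - α) < 2 * B / k := by
        rw [lt_div_iff₀ hk0]
        have hεαpos : 0 < ε ^ α := Real.rpow_pos_of_pos hε0 α
        have : k / 2 * (ε ^ (1 - α) * ε ^ α) < B * ε ^ α := by rw [← hsplit]; exact hcase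
        nlinarith
      -- raise to the power `β`: `(ε^{1-α})^β = ε^α`
      have hpow : ε ^ α < (2 * B / k) ^ β := by
        have := Real.rpow_lt_rpow (Real.rpow_nonneg hε _) hlt hβ0
        rwa [← Real.rpow_mul hε, show (1 - α) * β = α by rw [hβ]; field_simp] at this
      have hval : (2 * B / k) ^ β = 2 ^ β * B ^ β * k ^ (-β) := by
        rw [Real.div_rpow (by positivity) hk0.le, Real.mul_rpow zero_le_two hB.le, Real.rpow_neg hk0.le,
          div_eq_mul_inv]
      have hd2 : d ≤ B * (2 * B / k) ^ β := by
        have := mul_le_mul_of_nonneg_left hpow.le hB.le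
        linarith
      rw [hval] at hd2
      have : B * (2 ^ β * B ^ β * k ^ (-β)) ≤ 2 ^ β * (B + B * B ^ β) * k ^ (-β) := by
        have : 0 ≤ 2 ^ β * B * k ^ (-β) := by positivity
        nlinarith
      linarith

/-! ## §2 The face modulus on the spectrum (every field) -/

/-- ★★ **Integer power rate ⟹ Hölder face law** (every field): if `ω(1,k,1) − (k+1) ≤ C·k^{−δ}` for every integer
`k ≥ 1` (`C, δ > 0`; the shape of route `FarEdgeDescent`'s `PowerAmortisation`, `RateBeyond`), then every universal
spectral point obeys `θ₀+θ₁+θ₂−2 ≤ 2·C^{1/(1+δ)}·(1−θ₂)^{δ/(1+δ)}` (height law `θ₁ ≤ ε₀ + kε₂ + e(k)` of file 1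
and `holder_of_rate`). [cite: Strassen1988, Thm. 3.8] [cite: LottiRomani1983, Thm. 1] -/
theorem holderFace_of_farRate_nat {C δ : ℝ} (hC : 0 < C) (hδ : 0 < δ)
    (h : ∀ k : ℕ, 1 ≤ k → omegaRect K 1 k 1 - (k + 1) ≤ C * (k : ℝ) ^ (-δ))
    {F : SpectralMap K} (hF : IsUniversalSpectralPoint K F) :
    specMMPoint K F 0 + specMMPoint K F 1 + specMMPoint K F 2 - 2 ≤
      2 * C ^ (1 / (1 + δ)) * (1 - specMMPoint K F 2) ^ (δ / (1 + δ)) := by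
  have hε : 0 ≤ 1 - specMMPoint K F 2 := sub_nonneg.2 (AlmanLi2026.prop42_mem_Icc hF 2).2
  refine holder_of_rate hε hC hδ fun n hn => ?_
  have h1 := height_le_of_farExcess hF (k := (n : ℝ)) (Nat.cast_nonneg n)
  have h2 := h n hn
  have e : ((n : ℝ) - 1) * (1 - specMMPoint K F 2) = n * (1 - specMMPoint K F 2) - (1 - specMMPoint K F 2) := by
    ring
  linarith

/-- ★★ **Real power rate ⟹ Hölder face law** (every field): the same from `ω(1,k,1) − (k+1) ≤ C·k^{−δ}` for every
REAL `k ≥ 1` (the shape of lens 2's tower theorems). [cite: Strassen1988, Thm. 3.8] [cite: LottiRomani1983, Thm. 1] -/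
theorem holderFace_of_farRate {C δ : ℝ} (hC : 0 < C) (hδ : 0 < δ)
    (h : ∀ k : ℝ, 1 ≤ k → omegaRect K 1 k 1 - (k + 1) ≤ C * k ^ (-δ))
    {F : SpectralMap K} (hF : IsUniversalSpectralPoint K F) :
    specMMPoint K F 0 + specMMPoint K F 1 + specMMPoint K F 2 - 2 ≤
      2 * C ^ (1 / (1 + δ)) * (1 - specMMPoint K F 2) ^ (δ / (1 + δ)) :=
  holderFace_of_farRate_nat hC hδ (fun k hk => h k (by exact_mod_cast hk)) hF

/-- ★★ **Hölder face law ⟹ real power rate** (every field): if every universal spectral point obeys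
`θ₀+θ₁+θ₂−2 ≤ B·(1−θ₂)^α` (`B > 0`, `0 < α < 1`), then `ω(1,k,1) − (k+1) ≤ 2^β(B + B·B^β)·k^{−β}` for every real
`k ≥ 1`, `β = α/(1−α)` — Strassen duality `ω(1,1,k) = sup_φ(θ₀+θ₁+kθ₂)` (file 1's `isLUB_plane`), `ω(1,k,1) = ω(1,1,k)`,
and `rate_of_holder` pointwise. [cite: Strassen1988, Thm. 3.8] [cite: AlmanLi2026, Proposition 4.1] -/
theorem farRate_of_holderFace {B α : ℝ} (hB : 0 < B) (hα : 0 < α) (hα1 : α < 1)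
    (h : ∀ F : SpectralMap K, IsUniversalSpectralPoint K F →
      specMMPoint K F 0 + specMMPoint K F 1 + specMMPoint K F 2 - 2 ≤ B * (1 - specMMPoint K F 2) ^ α)
    {k : ℝ} (hk : 1 ≤ k) :
    omegaRect K 1 k 1 - (k + 1) ≤ 2 ^ (α / (1 - α)) * (B + B * B ^ (α / (1 - α))) * k ^ (-(α / (1 - α))) := by
  rw [omegaRect_swap₂₃ K 1 k 1, sub_le_iff_le_add]
  refine (isLUB_plane (K := K) zero_le_one (by linarith : (0 : ℝ) ≤ k)).2 ?_
  rintro _ ⟨F, hF, rfl⟩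
  have hθ2 := AlmanLi2026.prop42_mem_Icc hF 2
  have hd := rate_of_holder (sub_nonneg.2 hθ2.2) (by linarith [hθ2.1]) hB hα hα1 (h F hF) hk
  show specMMPoint K F 0 + 1 * specMMPoint K F 1 + k * specMMPoint K F 2 ≤ _
  have e : (k - 1) * (1 - specMMPoint K F 2) = k - 1 - k * specMMPoint K F 2 + specMMPoint K F 2 := by ring
  linarith

/-- **Hölder face law ⟹ integer power rate** (the `PowerAmortisation`/`RateBeyond` shape, every field).
[cite: Strassen1988, Thm. 3.8] [cite: LottiRomani1983, Prop. 4.1] -/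
theorem farRate_nat_of_holderFace {B α : ℝ} (hB : 0 < B) (hα : 0 < α) (hα1 : α < 1)
    (h : ∀ F : SpectralMap K, IsUniversalSpectralPoint K F →
      specMMPoint K F 0 + specMMPoint K F 1 + specMMPoint K F 2 - 2 ≤ B * (1 - specMMPoint K F 2) ^ α) :
    ∃ δ C : ℝ, 0 < δ ∧ δ = α / (1 - α) ∧ 0 < C ∧ ∀ k : ℕ, 1 ≤ k →
      omegaRect K 1 k 1 - (k + 1) ≤ C * (k : ℝ) ^ (-δ) := by
  have h1α : 0 < 1 - α := by linarith
  refine ⟨α / (1 - α), 2 ^ (α / (1 - α)) * (B + B * B ^ (α / (1 - α))), by positivity, rfl, ?_, fun k hk => ?_⟩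
  · have : 0 < B ^ (α / (1 - α)) := Real.rpow_pos_of_pos hB _
    have : 0 < (2 : ℝ) ^ (α / (1 - α)) := Real.rpow_pos_of_pos two_pos _
    positivity
  · exact farRate_of_holderFace hB hα hα1 h (k := (k : ℝ)) (by exact_mod_cast hk)

/-- **The two exponents are one number**: a power rate of exponent `δ > 0` gives the Hölder face law of exponent
`α = δ/(1+δ) ∈ (0,1)`, whose own rate exponent `α/(1−α)` is `δ` again — the exchange of §1–§2 loses constants,
never exponent. [folklore] -/
theorem rateExponent_of_holderExponent {δ : ℝ} (hδ : 0 < δ) :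
    (δ / (1 + δ)) / (1 - δ / (1 + δ)) = δ ∧ 0 < δ / (1 + δ) ∧ δ / (1 + δ) < 1 := by
  have h1δ : 0 < 1 + δ := by linarith
  refine ⟨?_, by positivity, by rw [div_lt_one h1δ]; linarith⟩
  field_simp
  ring

/-! ## §3 The proved rung: Hölder exponent `log 2 / log 11` over every field -/

/-- ★★ **PROVED: the darkness of the matrix-multiplication spectrum is Hölder of exponent `log 2/log 11` in the
depth below the light face**, over EVERY field: at every universal spectral point
`θ₀+θ₁+θ₂−2 ≤ 2·4^{log(11/2)/log 11}·(1−θ₂)^{log 2/log 11}` (exponent `0.28906…`, constant `5.359…`) — lens 2's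
pair-order tower `ω(1,k,1) − (k+1) ≤ 4·k^{−log 2/log(11/2)}` (`FarEdgeDescentTowerPairs`) through
`holderFace_of_farRate`; `(log 2/log(11/2))/(1 + log 2/log(11/2)) = log 2/log 11`.
[cite: LottiRomani1983, Prop. 4.1] [cite: CoppersmithWinograd1982, Thm. 1] [cite: Strassen1988, Thm. 3.8] -/
theorem holderFace_pairOrder {F : SpectralMap K} (hF : IsUniversalSpectralPoint K F) :
    specMMPoint K F 0 + specMMPoint K F 1 + specMMPoint K F 2 - 2 ≤
      2 * 4 ^ (Real.log (11 / 2) / Real.log 11) * (1 - specMMPoint K F 2) ^ (Real.log 2 / Real.log 11) := by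
  set δ : ℝ := Real.log 2 / Real.log (11 / 2) with hδ
  have hl2 : 0 < Real.log 2 := Real.log_pos (by norm_num)
  have hlb : 0 < Real.log (11 / 2 : ℝ) := Real.log_pos (by norm_num)
  have hl11 : Real.log (11 : ℝ) = Real.log (11 / 2) + Real.log 2 := by
    rw [← Real.log_mul (by norm_num) (by norm_num)]
    norm_num
  have hδ0 : 0 < δ := by positivity
  have h := holderFace_of_farRate (K := K) (by norm_num : (0 : ℝ) < 4) hδ0
    (fun k hk => excess_le_four_mul_rpow_pairOrder K hk) hF
  have e1 : 1 / (1 + δ) = Real.log (11 / 2) / Real.log 11 := by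
    rw [hl11, hδ]
    field_simp
  have e2 : δ / (1 + δ) = Real.log 2 / Real.log 11 := by
    rw [hl11, hδ]
    field_simp
  rw [← e1, ← e2]
  exact h

/-- ★ **The clean rung `d ≤ 6·ε₂^{2/7}`** over every field: from `ω(1,k,1) − (k+1) ≤ 4·k^{−2/5}`
(`excess_le_four_mul_rpow_two_fifths`), `(2/5)/(7/5) = 2/7` and `2·4^{5/7} ≤ 6` (`4⁵ = 1024 ≤ 2187 = 3⁷`).
[cite: LottiRomani1983, Prop. 4.1] [cite: CoppersmithWinograd1982, Thm. 1] -/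
theorem holderFace_two_sevenths {F : SpectralMap K} (hF : IsUniversalSpectralPoint K F) :
    specMMPoint K F 0 + specMMPoint K F 1 + specMMPoint K F 2 - 2 ≤
      6 * (1 - specMMPoint K F 2) ^ (2 / 7 : ℝ) := by
  have h := holderFace_of_farRate (K := K) (by norm_num : (0 : ℝ) < 4) (by norm_num : (0 : ℝ) < 2 / 5)
    (fun k hk => excess_le_four_mul_rpow_two_fifths K hk) hF
  have e1 : (1 : ℝ) / (1 + 2 / 5) = 5 / 7 := by norm_num
  have e2 : (2 / 5 : ℝ) / (1 + 2 / 5) = 2 / 7 := by norm_num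
  rw [e1, e2] at h
  have hε : 0 ≤ (1 - specMMPoint K F 2) ^ (2 / 7 : ℝ) :=
    Real.rpow_nonneg (sub_nonneg.2 (AlmanLi2026.prop42_mem_Icc hF 2).2) _
  -- `4^{5/7} ≤ 3`
  have h43 : (4 : ℝ) ^ (5 / 7 : ℝ) ≤ 3 := by
    have h7 : ((4 : ℝ) ^ (5 / 7 : ℝ)) ^ (7 : ℕ) = 4 ^ (5 : ℕ) := by
      rw [← Real.rpow_natCast, ← Real.rpow_mul (by norm_num : (0 : ℝ) ≤ 4)]
      norm_num
    refine le_of_pow_le_pow_left₀ (by norm_num : (7 : ℕ) ≠ 0) (by norm_num : (0 : ℝ) ≤ 3) ?_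
    rw [h7]
    norm_num
  nlinarith

/-- **The proved rung, packaged in the `∃ α B` shape of the dictionary** (every field): the Hölder face law holds
for SOME exponent `α ∈ (0,1)` — namely `α = 2/7` with `B = 6`. [cite: LottiRomani1983, Prop. 4.1] -/
theorem exists_holderFace :
    ∃ α B : ℝ, 0 < α ∧ α < 1 ∧ 0 < B ∧ ∀ F : SpectralMap K, IsUniversalSpectralPoint K F →
      specMMPoint K F 0 + specMMPoint K F 1 + specMMPoint K F 2 - 2 ≤ B * (1 - specMMPoint K F 2) ^ α :=
  ⟨2 / 7, 6, by norm_num, by norm_num, by norm_num, fun _ hF => holderFace_two_sevenths hF⟩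

/-- **Lipschitz is the far tight point** (the top of the face ladder, every field, real slope): the Lipschitz face
law `θ₀+θ₁+θ₂−2 ≤ (k−1)·(1−θ₂)` at every universal spectral point ⟺ `ω(1,k,1) ≤ k+1` (file 1's
`farTight_iff_roof`, rearranged) — the rung `FS_k` of the cut is the exponent-`1` end of the Hölder dial.
[cite: Strassen1988, Thm. 3.8] [cite: LottiRomani1983, Thm. 1] -/
theorem farTight_iff_lipschitzFace {k : ℝ} (hk : 0 ≤ k) :
    omegaRect K 1 k 1 ≤ k + 1 ↔ ∀ F : SpectralMap K, IsUniversalSpectralPoint K F →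
      specMMPoint K F 0 + specMMPoint K F 1 + specMMPoint K F 2 - 2 ≤ (k - 1) * (1 - specMMPoint K F 2) := by
  rw [farTight_iff_roof (K := K) hk]
  refine forall₂_congr fun F _ => ?_
  constructor <;> intro h <;> nlinarith [h]

end Summit.MatrixMultiplication.MatrixMultiplication.Theorems.SaturationLadderFaceModulus

end
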